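import Summits.QuantumFields.YangMills.Theorems.F4SubCurvatureDoorGlobalReductionCertificate
import Summits.QuantumFields.YangMills.Theorems.F4SubCurvatureDoorLaplaceFourierRegistered
import Summits.QuantumFields.YangMills.Theorems.F4SubCurvatureDoorFischerNormalForm
import Summits.QuantumFields.YangMills.Theorems.F4SubCurvatureDoorNullConePointednessRegistered
import Summits.QuantumFields.YangMills.Theorems.F4SubCurvatureDoorConeFatouEndgameRegistered
import Mathlib
import HarnessLib

/-!
# LINE g21-A «SHELL SEPARATION» — crux ⟨stmt-QuantumFields-23125⟩ `F4SubCurvatureDoor.RationalToGeneral`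
# (parent ⟨23035⟩ `ShortRootRigidity`; route `F4SubCurvatureDoor`; rung R2d `BalabanLadder.ROT` via `F4SubCurvatureDoor.closes`)

Seat `ym-idea-3` (D-0145 ideator, technique card «positivity / convexity»), generation g21.  Skeleton namespace
`…Cruxes.RationalToGeneral.ShellSeparation`.  A SECOND line on ⟨23125⟩, mechanism-distinct from the line of record
`Lines/sextic_channel.lean` (v5, «finite harmonic type from analyticity», wall T1″ `AnalyticFiniteType`) and from the two lines on the
parent ⟨23035⟩ (`transverse_slice`: Gaussian 4D→2D slice + planar rigidity; `angular_type`: planar light-cone spectral condition ⇒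
π/3-periodic entire angular function of type < 6).  It RE-DECLARES verbatim the two open stubs of `sextic_channel` (`stub_analyticFiniteType`,
kept claimable, NOT used below; `stub_channelShellForm`, USED below) so that registering this file keeps them served.

## The wall and the thesis of this line
C3 «GLOBAL SHORT-ROOT RIGIDITY» (tree certificate `rationalToGeneral_of_global`, p682986): a kernel `K : ℝ⁴ → ℝ` of the class
`InClass` (continuous off 0, bounded outside the unit ball, `W(B₄)`-invariant, reflection positive across `x₀ = 0`, sub-curvature budget
`‖x‖⁸K → 0`, invariant under `Aut D₄ = W(F₄)`) is `O(4)`-invariant.  Every class kernel has a LAPLACE–FOURIER MEASURE `μ ≥ 0` on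
`[0,∞) × ℝ³` (tree: `stub_laplaceFourier`, p696429): `K(t, z⃗) = ∫ e^{−tE} cos(q⃗·z⃗) dμ(E, q⃗)` for `t > 0`.  Write
`q := E² − |q⃗|²` (MASS SQUARED, `massSq`).  THESIS OF THE LINE: the `W(F₄)`-symmetry of `K` holds MASS-SHELL BY MASS-SHELL —
for every Borel set `S` of values of `q`, the sub-kernel `K_S(t, z⃗) := ∫_{q ∈ S} e^{−tE} cos(q⃗·z⃗) dμ` is again a (budget-free)
class kernel — as soon as `μ` carries no space-like mass of arbitrarily negative `q` (`stub_shellSeparation`, THE NEW LEVER); the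
forward light cone `E ≥ |q⃗|` carries `μ` (`stub_forwardConeSupport`, the 4D form of the budget-free spectral condition); and a
budgeted superposition of `W(F₄)`-symmetric mass shells has finitely many harmonic channels (`stub_shellFiniteType`, the budgeted
tower exclusion).  Finite type then feeds the LANDED endgame of `sextic_channel` v5 (Fischer ✓p696610, null-cone pointedness ✓p693349,
cone–Fatou ✓p695323, Laplace–Fourier ✓p696429) plus its one open L-stub `ChannelShellForm`, and the tree certificate closes ⟨23125⟩
BY NAME (`RationalToGeneral_of_shells`, kernel-checked below, sorries = the five stubs).

## Why shell separation holds (the mechanism of `stub_shellSeparation`; paper proof, M–L)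
Fix `w ∈ W(F₄)` and `x` off the two mirrors `x₀ = 0`, `(wx)₀ = 0`.  (1) `K` is real-analytic on `ℝ⁴ ∖ 0` (tree: mirror analyticity
p687956), so `ΔᵏK` is defined and `W(F₄)`-invariant on `ℝ⁴ ∖ 0` for every `k`.  (2) On `x₀ ≠ 0`, differentiating the Laplace–Fourier
integral (the moments `∫ (E² + |q⃗|²)ᵏ e^{−tE} dμ` are finite: `E`-moments always, `q⃗`-moments because `z⃗ ↦ K(t, z⃗)` is real-analytic,
or because `|q⃗| ≤ E` on the cone) gives `ΔᵏK(t, z⃗) = ∫ qᵏ e^{−tE} cos(q⃗·z⃗) dμ`: THE LAPLACIAN IS MULTIPLICATION BY THE MASS SQUARED.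
(3) Hence the two signed measures on the `q`-line, `τ¹ₓ := q_*(e^{−|x₀|E} cos(q⃗·x⃗) μ)` and `τ²ₓ := q_*(e^{−|(wx)₀|E} cos(q⃗·(wx)⃗) μ)`,
have ALL MOMENTS EQUAL (`∫ qᵏ dτ¹ₓ = ΔᵏK(x) = ΔᵏK(wx) = ∫ qᵏ dτ²ₓ`).  (4) Tails: `{q > Q} ⊂ {E > √Q}`, so `|τⁱₓ|{q > Q} ≤ e^{−c√Q}·K(c, 0)`
with `c = min(|x₀|, |(wx)₀|)/2`; if moreover `q ≥ −Q₀` on `supp μ` (NO DEEP SPACE-LIKE MASS — implied by forward-cone support with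
`Q₀ = 0`), the moment problem for `τⁱₓ` is a STIELTJES problem with `e^{−c√q}` tails, hence DETERMINATE (push forward to `λ = √(q+Q₀)`:
exponential moments ⇒ the even extension has an analytic characteristic function ⇒ the moments decide; Carleman–Stieltjes,
[Akhiezer1965, Ch. 2 §5; Schmudgen2020, Lect. 4]).  So `τ¹ₓ = τ²ₓ`, i.e. `∫ φ(q) e^{−|x₀|E} cos(q⃗·x⃗) dμ = ∫ φ(q) e^{−|(wx)₀|E} cos(q⃗·(wx)⃗) dμ`
for every bounded Borel `φ`: EVERY MASS MULTIPLIER OF `μ` IS AGAIN `W(F₄)`-SYMMETRIC off the mirrors; the 24 short roots span, so the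
half-space formulas glue to one kernel `K_S` continuous off `0`, bounded outside the unit ball (chamber frame: `|⟪u, x⟫| ≥ ‖x‖/√2`
for some short root `u` — the 24-cell's covering angle is 45°), reflection positive (`μ|_{q∈S} ≥ 0`) — a budget-free class kernel with Laplace–Fourier measure `μ|_{q ∈ S}`.
WHY THE CONE IS LOAD-BEARING: with space-like mass of unbounded `−q` the problem in (4) is a two-sided HAMBURGER problem with
`e^{−c√|q|}` tails, which is INDETERMINATE, and one-point conspiracies exist (e.g. `β(λ)dλ = e^{−ελ} sin λ dλ` on the space-like side
against the time-like measure whose cosine transform is the bounded rational continuation of `∫ cosh(ηλ) dβ`): the light cone is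
exactly what makes mass separation a one-sided problem.  Degree two is also sharp among invariant operators: for the invariants of
degrees 6, 8, 12 the tails are `e^{−c q^{1/6}}` etc. and NOTHING separates (as it must be: separating all four invariants would force
`μ` to be a point mass).

## Obligations (registered stubs: five, each a genuine lemma; sizes XL · M–L · XL · L · XL)
* `stub_forwardConeSupport` (XL; «4D SPECTRAL CONE», budget-free in spirit): the Laplace–Fourier measure of a class kernel is carried by
  the closed forward light cone `E ≥ |q⃗|`.  Same technique family as `angular_type`'s planar stub (C) (OS sector continuation on the
  60° short-root frame pairs, cross theorem, Paley–Wiener, tube bootstrap), but a different OUTPUT (support, in 4D).  FIRST RUNG (M,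
  conditional on (C)): (C) applied to the Gaussian transverse slices `slice 0 K` (tree `SliceInClass` ✓p706499) gives the POLYHEDRAL cone
  `E ≥ ‖q⃗‖₁/√3` (the cube inscribed in the ball, touching it along the 8 half-integer short-root directions); the round cone is the
  `W(F₄)`-tube-bootstrap fixed point.  WHY IT MIGHT FAIL: a budget-free class kernel with a compact space-like piece of `μ` (invisible to
  tube holomorphy) — then restate with the budget used, or prove only `q ≥ −Q₀`, which is all `stub_shellSeparation` needs.
* `stub_shellSeparation` (M–L; THE NEW LEVER, mechanism above): no deep space-like mass ⇒ every mass multiplier of `μ` is a budget-free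
  class kernel.  WHY IT MIGHT FAIL: it should not — steps (1)–(4) are a proof; Lean cost = differentiation under the Laplace–Fourier
  integral, the Laplacian of a real-analytic function in coordinates, determinacy via `ProbabilityTheory.complexMGF` analyticity.
* `stub_shellFiniteType` (XL; «BUDGETED SHELL FAMILIES HAVE FINITE TYPE»): a class kernel (budget!) whose forward-cone Laplace–Fourier
  measure is shell-separated (every mass multiplier a class kernel) has finitely many harmonic channels.  Content: single-shell class
  kernels are `G(∂)Δ_m` with `G` a `W(F₄)`-invariant polynomial (densities on ONE hyperboloid compatible with the 24 frames), and the
  BUDGETED TOWER EXCLUSION across shells: with shells and per-shell positivity in hand the budget reads `∫ m^{2j} dχ_L(m) = 0`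
  (`0 ≤ 2j ≤ L − 8`) per anisotropic layer `L` (Mellin: the profile `u^{L+1}K_{L+1}(u)` has Mellin transform `2^{s−2}Γ(s/2)Γ(s/2+L+1)/(2^L L!)`,
  poles at `s = 0, −2, …`), the top layer of every shell is positive (`H_L|_{null} ≥ 0`), and the layered alternation A′ (HOME
  l15/LAYERED-ALTERNATION.md: positivity + zero mass kills the top layer; descend) closes when the layer degrees are bounded; the residual
  is the infinite ascent («floor dichotomy», T1pp_tower_economy_II.md) — THE SAME residual as T1″'s, but posed WITH the shell structure and
  per-shell positivity instead of analyticity.  WHY IT MIGHT FAIL: an infinite budgeted ascent of positive-topped shells exists — then C3 is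
  false and ⟨23125⟩ with it (record as a negative).
* `stub_channelShellForm` (L; verbatim from `sextic_channel` v5, USED) and `stub_analyticFiniteType` (XL; verbatim, kept claimable, NOT used).
PROVED HERE (sorry-free): `finiteType_of_shells` (the three new stubs + tree LF ⇒ `FiniteType`), and — copied verbatim from
`sextic_channel` v5, whose Lines file is not importable — `topChannelCone_of`, `radial_of_harmonicExpansion`, `finiteTypeRigidity_of`,
`globalRigidity_of_channels`, with the landed stubs consumed BY NAME (`stub_laplaceFourier`, `stub_fischerNormalForm`,
`stub_nullConePointedness`, `stub_coneFatouEndgame`); composition `RationalToGeneral_of_shells : RationalToGeneral`.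

BEARS ON: ⟨23125⟩ → ⟨23035⟩ → `F4SubCurvatureDoor.closes` → rung R2d (ROT).  CHEAPEST FALSIFIER: of the lever — a class kernel with two
mass shells whose crossing residuals cancel (impossible: `(Δ − m₁²)` kills one and not the other; the finite-shell case of (3)–(4) is
Vandermonde); of the line — the homogeneous crossing LP at degree `a < 8` (instrument «homogeneous crossing LP(a)», card §Instrument) or a
budgeted infinite ascent in the toy tower economy (T1pp_tower_economy_II.md).  HONEST LABEL: nothing here proves C3, ⟨23125⟩, ⟨23035⟩,
rung R2d or the summit; the Yang–Mills mass gap is NOT proved.  No summit is proved by a line.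
-/

set_option autoImplicit false

noncomputable section

namespace Summit.QuantumFields.YangMills.Cruxes.RationalToGeneral.ShellSeparation

open scoped Topology BigOperators
open Filter Set MeasureTheory
open Literature.MathematicalPhysics.QuantumLattice (timeReflection siteToE)
open Summit.QuantumFields.YangMills.Cruxes.OSLegsAtWeakCouplingC.Sketch (IsSignedPerm)
open Summit.QuantumFields.YangMills.Theses.F4SubCurvatureDoor (ShortRootRigidity RationalToGeneral)
open Summit.QuantumFields.YangMills.Theorems.F4SubCurvatureDoorGlobalReduction (rationalToGeneral_of_global)
open Summit.QuantumFields.YangMills.Theorems.F4SubCurvatureDoorLaplaceFourierRegistered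
  (E4 E3 InClass timeSpace IsLF LaplaceFourier stub_laplaceFourier)
open Summit.QuantumFields.YangMills.Theorems.F4SubCurvatureDoorFischerNormalForm
  (laplacian IsHarmonicPoly r2poly FischerNormalForm stub_fischerNormalForm)

/-! ## Vocabulary -/

/-- The MASS SQUARED `q = E² − |q⃗|²` of a Laplace–Fourier momentum `(E, q⃗)` (problem-side definition). -/
def massSq (p : ℝ × E3) : ℝ := p.1 ^ 2 - ‖p.2‖ ^ 2

/-- The BUDGET-FREE class: `InClass` without the sub-curvature conjunct — continuous off `0`, bounded outside the unit ball,
`W(B₄)`-invariant, reflection positive across `x₀ = 0`, invariant under the isometries preserving `D₄` (problem-side definition). -/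
def InClass₀ (K : E4 → ℝ) : Prop :=
  ContinuousOn K {x | x ≠ 0} ∧
  (∃ C : ℝ, ∀ x, 1 ≤ ‖x‖ → |K x| ≤ C) ∧
  (∀ R : E4 ≃ₗᵢ[ℝ] E4, IsSignedPerm R → ∀ x, K (R x) = K x) ∧
  (∀ (m : ℕ) (x : Fin m → E4) (c : Fin m → ℝ), (∀ i, 0 < x i 0) →
      0 ≤ ∑ i, ∑ j, c i * c j * K (timeReflection 4 (x i) - x j)) ∧
  (∀ R : E4 ≃ₗᵢ[ℝ] E4,
      (∀ z : Fin 4 → ℤ, Even (∑ i, z i) → ∃ w : Fin 4 → ℤ, Even (∑ i, w i) ∧ R (siteToE z) = siteToE w) →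
      ∀ x, K (R x) = K x)

/-- `μ` is SHELL-SEPARATED: every mass multiplier `μ|_{q ∈ S}` (`S` Borel) is the Laplace–Fourier measure of a budget-free class
kernel (problem-side definition). -/
def ShellSeparated (μ : Measure (ℝ × E3)) : Prop :=
  ∀ S : Set ℝ, MeasurableSet S → ∃ KS : E4 → ℝ, InClass₀ KS ∧ IsLF KS (μ.restrict (massSq ⁻¹' S))

/-- Finite harmonic type of ONE kernel off the origin: finitely many (radial profile) × (polynomial) terms (the conclusion of
`sextic_channel`'s `FiniteType`, per kernel; problem-side definition). -/
def HasFiniteType (K : E4 → ℝ) : Prop :=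
  ∃ (N : ℕ) (P : Fin N → MvPolynomial (Fin 4) ℝ) (g : Fin N → ℝ → ℝ),
    ∀ x : E4, x ≠ 0 → K x = ∑ j, g j (‖x‖ ^ 2) * MvPolynomial.eval (fun i => x i) (P j)

/-! ## The three new obligations -/

/-- Stub «FORWARD-CONE SUPPORT» (XL; 4D spectral condition): the Laplace–Fourier measure of a class kernel is carried by the closed
forward light cone `E ≥ |q⃗|`.  Technique family of `angular_type` (C) (OS two-slot sector continuation on the 60° short-root frame pairs
[OsterwalderSchraderCMP1975 Thm 4.1, 4.4; GlimmJaffeQP1987 §19.6], Siciak's cross theorem [JarnickiPflug2011 Ch. 5], Paley–Wiener for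
positive measures, tube bootstrap); first rung = the polyhedral cone `E ≥ ‖q⃗‖₁/√3` from (C) on the Gaussian slices.  Implied by C3
(radial RP kernels are Källén–Lehmann).  WHY IT MIGHT FAIL: a compactly supported space-like piece of `μ` invisible to tube holomorphy;
fallback = the weaker `μ {q < −Q₀} = 0`, which is all the next stub uses. -/
def ForwardConeSupport : Prop :=
  ∀ K : E4 → ℝ, InClass K → ∀ μ : Measure (ℝ × E3), IsLF K μ → μ {p | p.1 < ‖p.2‖} = 0

/-- Stub «SHELL SEPARATION» (M–L; THE NEW LEVER): if the Laplace–Fourier measure of a class kernel carries no space-like mass below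
`q = −Q₀`, then it is shell-separated.  Mechanism: the Laplacian is multiplication by `q` on the Laplace–Fourier side; `ΔᵏK` is
`W(F₄)`-invariant (mirror analyticity, tree p687956); the two `q`-push-forwards at `x` and `wx` have equal moments and `e^{−c√q}` tails on a
half-line ⇒ Stieltjes-determinate ⇒ equal [Akhiezer1965 Ch. 2 §5; Schmudgen2020 Lect. 4]; glue over the 24 frames.  Implied by C3.
WHY IT MIGHT FAIL: it should not (paper proof in the module docstring); Lean infrastructure only. -/
def ShellSeparation : Prop :=
  ∀ K : E4 → ℝ, InClass K → ∀ μ : Measure (ℝ × E3), IsLF K μ →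
    ∀ Q₀ : ℝ, μ {p | massSq p < -Q₀} = 0 → ShellSeparated μ

/-- Stub «BUDGETED SHELL FAMILIES HAVE FINITE TYPE» (XL; the budgeted tower exclusion): a class kernel (with the budget `‖x‖⁸K → 0`)
whose Laplace–Fourier measure is carried by the forward cone and shell-separated has finitely many harmonic channels.  Content:
single-shell class kernels are `G(∂)Δ_m` (`G` a `W(F₄)`-invariant polynomial); Mellin form of the channel budget
(`∫ m^{2j} dχ_L = 0`, `2j ≤ L − 8`); positivity of every shell's top layer; layered alternation A′ [HOME l15/LAYERED-ALTERNATION.md] for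
bounded layer degree; the residual is the infinite ascent (T1pp_tower_economy_II.md «floor dichotomy»).  Implied by C3 (radial ⇒ one
channel).  WHY IT MIGHT FAIL: a budgeted infinite ascent of positive-topped shells — then C3 is false (record as a negative). -/
def ShellFiniteType : Prop :=
  ∀ K : E4 → ℝ, InClass K → ∀ μ : Measure (ℝ × E3), IsLF K μ →
    μ {p | p.1 < ‖p.2‖} = 0 → ShellSeparated μ → HasFiniteType K

theorem stub_forwardConeSupport : ForwardConeSupport := by
  sorry

theorem stub_shellSeparation : ShellSeparation := by
  sorry

theorem stub_shellFiniteType : ShellFiniteType := by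
  sorry

/-! ## The statements of `sextic_channel` v5 this line consumes (verbatim texts, over the tree's name-keyed `InClass`/`IsLF` and the
tree's `IsHarmonicPoly`/`r2poly` of `F4SubCurvatureDoorFischerNormalForm`) -/

/-- `sextic_channel`'s T1' «FINITE SO(4)-TYPE» (verbatim). -/
def FiniteType : Prop :=
  ∀ K : E4 → ℝ, InClass K →
    ∃ (N : ℕ) (P : Fin N → MvPolynomial (Fin 4) ℝ) (g : Fin N → ℝ → ℝ),
      ∀ x : E4, x ≠ 0 → K x = ∑ j, g j (‖x‖ ^ 2) * MvPolynomial.eval (fun i => x i) (P j)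

/-- `sextic_channel`'s T1″ «ANALYTIC FINITE TYPE» (verbatim; the wall of the line of record — RE-DECLARED below to keep it served; NOT used
by this line's composition). -/
def AnalyticFiniteType : Prop :=
  ∀ K : E4 → ℝ, InClass K → (∀ x : E4, x ≠ 0 → AnalyticAt ℝ K x) →
    ∃ (N : ℕ) (P : Fin N → MvPolynomial (Fin 4) ℝ) (g : Fin N → ℝ → ℝ),
      ∀ x : E4, x ≠ 0 → K x = ∑ j, g j (‖x‖ ^ 2) * MvPolynomial.eval (fun i => x i) (P j)

/-- `sextic_channel`'s T2′ «FINITE-TYPE RIGIDITY» (verbatim). -/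
def FiniteTypeRigidity : Prop :=
  ∀ K : E4 → ℝ, InClass K →
    ∀ (N : ℕ) (P : Fin N → MvPolynomial (Fin 4) ℝ) (g : Fin N → ℝ → ℝ),
      (∀ x : E4, x ≠ 0 → K x = ∑ j, g j (‖x‖ ^ 2) * MvPolynomial.eval (fun i => x i) (P j)) →
      ∃ g₀ : ℝ → ℝ, ∀ x : E4, x ≠ 0 → K x = g₀ (‖x‖ ^ 2)

/-- Complex evaluation at the forward null momentum `(i‖q⃗‖, q⃗)` (verbatim from `sextic_channel`). -/
def nullEval (P : MvPolynomial (Fin 4) ℝ) (q : E3) : ℂ :=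
  MvPolynomial.aeval (Fin.cons (Complex.I * (‖q‖ : ℂ)) (fun j : Fin 3 => ((q j : ℝ) : ℂ))) P

/-- `sextic_channel`'s «NULL-CONE POINTEDNESS» (verbatim; LANDED p693349). -/
def NullConePointedness : Prop :=
  ∀ (L : ℕ) (P : MvPolynomial (Fin 4) ℝ), P.IsHomogeneous L → IsHarmonicPoly P →
    (∀ q : E3, nullEval P q = 0) → P = 0

/-- `sextic_channel`'s «CONE–FATOU ENDGAME» (verbatim; LANDED p695323). -/
def ConeFatouEndgame : Prop :=
  ∀ (φ : ℝ → ℝ), Measurable φ → (∀ u, 0 ≤ φ u) → ContinuousWithinAt φ (Set.Ici 0) 0 → 0 < φ 0 →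
  ∀ (A : Type) [Fintype A] (N : A → E3 → ℝ) (ρp ρm : A → Measure ℝ),
    (∀ a, IsLocallyFiniteMeasure (ρp a) ∧ IsLocallyFiniteMeasure (ρm a)) →
    (∀ a, (ρp a) (Set.Iio 0) = 0 ∧ (ρm a) (Set.Iio 0) = 0) →
    (∀ v : A → ℝ, (∀ q : E3, ∑ a, v a * N a q = 0) → v = 0) →
    (∀ S : Set ℝ, MeasurableSet S → Bornology.IsBounded S →
        ∀ q : E3, 0 ≤ ∑ a, (((ρp a) S).toReal - ((ρm a) S).toReal) * N a q) →
    (∀ a (r : ℝ), 0 < r → Integrable (fun M => φ (M * r)) (ρp a) ∧ Integrable (fun M => φ (M * r)) (ρm a)) →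
    (∀ a, Tendsto (fun r : ℝ => (∫ M, φ (M * r) ∂(ρp a)) - ∫ M, φ (M * r) ∂(ρm a)) (𝓝[>] 0) (𝓝 0)) →
    ∀ a, ρp a = ρm a

/-- `sextic_channel`'s «TOP-CHANNEL CONE» (verbatim). -/
def TopChannelCone : Prop :=
  ∀ K : E4 → ℝ, InClass K → ∀ μ : Measure (ℝ × E3), IsLF K μ →
    ∀ (ι : Type) [Fintype ι] (H : ι → MvPolynomial (Fin 4) ℝ) (d : ι → ℕ) (g : ι → ℝ → ℝ),
      (∀ k, (H k).IsHomogeneous (d k)) → (∀ k, IsHarmonicPoly (H k)) →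
      (∀ x : E4, x ≠ 0 → K x = ∑ k, g k (‖x‖ ^ 2) * MvPolynomial.eval (fun i => x i) (H k)) →
      ∀ L : ℕ, 0 < L → (∀ k, d k ≤ L) →
      ∀ x : E4, x ≠ 0 →
        ∑ k ∈ Finset.univ.filter (fun k => d k = L), g k (‖x‖ ^ 2) * MvPolynomial.eval (fun i => x i) (H k) = 0

/-- `sextic_channel`'s «CHANNEL SHELL FORM» (verbatim; its one open L-stub besides the wall; RE-DECLARED and USED below). -/
def ChannelShellForm : Prop :=
  ∀ K : E4 → ℝ, InClass K → ∀ μ : Measure (ℝ × E3), IsLF K μ →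
    ∀ (ι : Type) [Fintype ι] (H : ι → MvPolynomial (Fin 4) ℝ) (d : ι → ℕ) (g : ι → ℝ → ℝ),
      (∀ k, (H k).IsHomogeneous (d k)) → (∀ k, IsHarmonicPoly (H k)) →
      (∀ x : E4, x ≠ 0 → K x = ∑ k, g k (‖x‖ ^ 2) * MvPolynomial.eval (fun i => x i) (H k)) →
      ∀ L : ℕ, 0 < L → (∀ k, d k ≤ L) →
      ∃ (φ : ℝ → ℝ) (A : Type) (_ : Fintype A) (Ht : A → MvPolynomial (Fin 4) ℝ) (ρp ρm : A → Measure ℝ) (C : ℝ → ℝ),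
        Measurable φ ∧ (∀ u, 0 ≤ φ u) ∧ ContinuousWithinAt φ (Set.Ici 0) 0 ∧ 0 < φ 0 ∧
        (∀ a, (Ht a).IsHomogeneous L) ∧ (∀ a, IsHarmonicPoly (Ht a)) ∧ LinearIndependent ℝ Ht ∧
        (∀ a (q : E3), (nullEval (Ht a) q).im = 0) ∧
        (∀ a, IsLocallyFiniteMeasure (ρp a) ∧ IsLocallyFiniteMeasure (ρm a)) ∧
        (∀ a, (ρp a) (Set.Iio 0) = 0 ∧ (ρm a) (Set.Iio 0) = 0) ∧
        (∀ S : Set ℝ, MeasurableSet S → Bornology.IsBounded S →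
            ∀ q : E3, 0 ≤ ∑ a, (((ρp a) S).toReal - ((ρm a) S).toReal) * (nullEval (Ht a) q).re) ∧
        (∀ a (r : ℝ), 0 < r → Integrable (fun M => φ (M * r)) (ρp a) ∧ Integrable (fun M => φ (M * r)) (ρm a)) ∧
        (∀ a, Tendsto (fun r : ℝ => (∫ M, φ (M * r) ∂(ρp a)) - ∫ M, φ (M * r) ∂(ρm a)) (𝓝[>] 0) (𝓝 0)) ∧
        (∀ x : E4, x ≠ 0 →
          ∑ k ∈ Finset.univ.filter (fun k => d k = L), g k (‖x‖ ^ 2) * MvPolynomial.eval (fun i => x i) (H k)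
            = C ‖x‖ * ∑ a, MvPolynomial.eval (fun i => x i) (Ht a) *
                ((∫ M, φ (M * ‖x‖) ∂(ρp a)) - ∫ M, φ (M * ‖x‖) ∂(ρm a)))

/-- Re-declared open stub of `sextic_channel` (T1″, the wall of the line of record; kept claimable, NOT used by this line). -/
theorem stub_analyticFiniteType : AnalyticFiniteType := by
  sorry

/-- Re-declared open stub of `sextic_channel` (L; USED by this line's composition). -/
theorem stub_channelShellForm : ChannelShellForm := by
  sorry

/-! ## Landed obligations, BY NAME (tree theorems; the name-keyed statements agree definitionally) -/

theorem nullConePointedness_holds : NullConePointedness :=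
  fun L P hhom hharm hnull =>
    Summit.QuantumFields.YangMills.Theorems.F4SubCurvatureDoorNullConePointednessRegistered.stub_nullConePointedness
      L P hhom hharm hnull

theorem coneFatouEndgame_holds : ConeFatouEndgame :=
  Summit.QuantumFields.YangMills.Theorems.F4SubCurvatureDoorConeFatouEndgameRegistered.stub_coneFatouEndgame

/-! ## Composition, part 1 (NEW): forward cone + shell separation + budgeted tower exclusion ⇒ finite type -/

/-- Deep space-like mass is absent under forward-cone support: `{q < 0} ⊆ {E < |q⃗|}`. -/
theorem massSq_neg_null (μ : Measure (ℝ × E3)) (hc : μ {p | p.1 < ‖p.2‖} = 0) :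
    μ {p | massSq p < -0} = 0 := by
  refine measure_mono_null (fun p hp => ?_) hc
  simp only [Set.mem_setOf_eq, massSq, neg_zero, sub_neg] at hp ⊢
  exact lt_of_le_of_lt (le_abs_self _) (abs_lt_of_sq_lt_sq hp (norm_nonneg _))

/-- **NEW COMPOSITION (proved)**: the three new stubs and the tree's Laplace–Fourier measure give `sextic_channel`'s `FiniteType`. -/
theorem finiteType_of_shells (h1 : ForwardConeSupport) (h2 : ShellSeparation) (h3 : ShellFiniteType) : FiniteType := by
  intro K hK
  obtain ⟨μ, hμ⟩ := stub_laplaceFourier K hK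
  have hc : μ {p | p.1 < ‖p.2‖} = 0 := h1 K hK μ hμ
  have hsep : ShellSeparated μ := h2 K hK μ hμ 0 (massSq_neg_null μ hc)
  exact h3 K hK μ hμ hc hsep

/-! ## Composition, part 2 (copied verbatim from `sextic_channel` v5, proved): CSF + NCP + CFE ⇒ top-channel cone ⇒ T2′; T1' + T2′ ⇒ C3 -/

theorem isHarmonicPoly_one : IsHarmonicPoly 1 := by
  simp [IsHarmonicPoly, laplacian]

/-- The Laplacian on `MvPolynomial (Fin 4) ℝ` as a linear map (bookkeeping for `laplacian`). -/
def laplacianLM : MvPolynomial (Fin 4) ℝ →ₗ[ℝ] MvPolynomial (Fin 4) ℝ :=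
  ∑ i : Fin 4, (MvPolynomial.pderiv i).toLinearMap ∘ₗ (MvPolynomial.pderiv i).toLinearMap

theorem laplacianLM_apply (P : MvPolynomial (Fin 4) ℝ) : laplacianLM P = laplacian P := by
  simp [laplacianLM, laplacian, LinearMap.sum_apply]

theorem isHarmonicPoly_sum_smul {A : Type} [Fintype A] (v : A → ℝ) (P : A → MvPolynomial (Fin 4) ℝ)
    (h : ∀ a, IsHarmonicPoly (P a)) : IsHarmonicPoly (∑ a, v a • P a) := by
  unfold IsHarmonicPoly at h ⊢
  rw [← laplacianLM_apply, map_sum]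
  refine Finset.sum_eq_zero (fun a _ => ?_)
  rw [map_smul, laplacianLM_apply, h a, smul_zero]

theorem nullEval_sum_smul {A : Type} [Fintype A] (v : A → ℝ) (P : A → MvPolynomial (Fin 4) ℝ) (q : E3) :
    nullEval (∑ a, v a • P a) q = ∑ a, (v a : ℂ) * nullEval (P a) q := by
  unfold nullEval
  rw [map_sum]
  refine Finset.sum_congr rfl (fun a _ => ?_)
  rw [map_smul, Complex.real_smul]

/-- Channel shell form + null-cone pointedness + cone–Fatou endgame ⇒ the top-channel cone (verbatim from `sextic_channel` v5). -/
theorem topChannelCone_of (hN : NullConePointedness) (hCF : ChannelShellForm) (hE : ConeFatouEndgame) :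
    TopChannelCone := by
  intro K hK μ hμ ι _ H d g hH hharm hexp L hL hd x hx
  obtain ⟨φ, A, _, Ht, ρp, ρm, C, hφm, hφ0, hφc, hφpos, hHtL, hHth, hLI, hreal, hlf, hsupp, hcone, hint, hbud, hR⟩ :=
    hCF K hK μ hμ ι H d g hH hharm hexp L hL hd
  have hpt : ∀ v : A → ℝ, (∀ q : E3, ∑ a, v a * (nullEval (Ht a) q).re = 0) → v = 0 := by
    intro v hv
    have hP0 : ∑ a, v a • Ht a = 0 := by
      refine hN L _ ?_ (isHarmonicPoly_sum_smul v Ht hHth) ?_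
      · refine MvPolynomial.IsHomogeneous.sum _ _ _ (fun a _ => ?_)
        rw [MvPolynomial.smul_eq_C_mul]
        simpa using (MvPolynomial.isHomogeneous_C (Fin 4) (v a)).mul (hHtL a)
      · intro q
        rw [nullEval_sum_smul]
        apply Complex.ext
        · rw [Complex.re_sum, Complex.zero_re]
          simpa [Complex.re_ofReal_mul] using hv q
        · rw [Complex.im_sum, Complex.zero_im]
          refine Finset.sum_eq_zero (fun a _ => ?_)
          rw [Complex.im_ofReal_mul, hreal a q, mul_zero]
    funext a
    exact (Fintype.linearIndependent_iff.mp hLI v hP0) a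
  have hz : ∀ a, ρp a = ρm a :=
    hE φ hφm hφ0 hφc hφpos A (fun a q => (nullEval (Ht a) q).re) ρp ρm hlf hsupp hpt hcone hint hbud
  rw [hR x hx]
  simp [hz]

/-- Downward induction on the top degree (verbatim from `sextic_channel` v5). -/
theorem radial_of_harmonicExpansion (hT : TopChannelCone) (K : E4 → ℝ) (hK : InClass K) (μ : Measure (ℝ × E3))
    (hμ : IsLF K μ) :
    ∀ (L : ℕ) (ι : Type) [Fintype ι] (H : ι → MvPolynomial (Fin 4) ℝ) (d : ι → ℕ) (g : ι → ℝ → ℝ),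
      (∀ k, (H k).IsHomogeneous (d k)) → (∀ k, IsHarmonicPoly (H k)) → (∀ k, d k ≤ L) →
      (∀ x : E4, x ≠ 0 → K x = ∑ k, g k (‖x‖ ^ 2) * MvPolynomial.eval (fun i => x i) (H k)) →
      ∃ g₀ : ℝ → ℝ, ∀ x : E4, x ≠ 0 → K x = g₀ (‖x‖ ^ 2) := by
  intro L
  induction L with
  | zero =>
    intro ι _ H d g hhom _ hdeg hrep
    refine ⟨fun s => ∑ k, g k s * MvPolynomial.coeff 0 (H k), fun x hx => ?_⟩
    rw [hrep x hx]
    refine Finset.sum_congr rfl fun k _ => ?_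
    have h0 : (H k).IsHomogeneous 0 := by
      have hk : d k = 0 := Nat.le_zero.mp (hdeg k)
      simpa [hk] using hhom k
    have hC : H k = MvPolynomial.C (MvPolynomial.coeff 0 (H k)) :=
      MvPolynomial.totalDegree_eq_zero_iff_eq_C.mp
        ((MvPolynomial.totalDegree_zero_iff_isHomogeneous (Fin 4)).mpr h0)
    calc g k (‖x‖ ^ 2) * MvPolynomial.eval (fun i => x i) (H k)
        = g k (‖x‖ ^ 2) * MvPolynomial.eval (fun i => x i) (MvPolynomial.C (MvPolynomial.coeff 0 (H k))) := by
          rw [← hC]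
      _ = g k (‖x‖ ^ 2) * MvPolynomial.coeff 0 (H k) := by rw [MvPolynomial.eval_C]
  | succ L ih =>
    intro ι _ H d g hhom hharm hdeg hrep
    classical
    have htop := hT K hK μ hμ ι H d g hhom hharm hrep (L + 1) (Nat.succ_pos L) hdeg
    let g' : ι → ℝ → ℝ := fun k => if d k = L + 1 then (fun _ => 0) else g k
    let H' : ι → MvPolynomial (Fin 4) ℝ := fun k => if d k = L + 1 then 1 else H k
    let d' : ι → ℕ := fun k => if d k = L + 1 then 0 else d k
    refine ih ι H' d' g' ?_ ?_ ?_ ?_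
    · intro k
      by_cases hk : d k = L + 1
      · simpa [H', d', hk] using MvPolynomial.isHomogeneous_one (Fin 4) ℝ
      · simpa [H', d', hk] using hhom k
    · intro k
      by_cases hk : d k = L + 1
      · simpa [H', hk] using isHarmonicPoly_one
      · simpa [H', hk] using hharm k
    · intro k
      by_cases hk : d k = L + 1
      · simp [d', hk]
      · have := hdeg k
        simp only [d', hk, if_false]
        omega
    · intro x hx
      rw [hrep x hx, ← Finset.sum_filter_add_sum_filter_not Finset.univ (fun k => d k = L + 1), htop x hx, zero_add,
        ← Finset.sum_filter_add_sum_filter_not Finset.univ (fun k => d k = L + 1) (fun k => g' k _ * _)]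
      have h1 : ∑ k ∈ Finset.univ.filter (fun k => d k = L + 1),
          g' k (‖x‖ ^ 2) * MvPolynomial.eval (fun i => x i) (H' k) = 0 := by
        refine Finset.sum_eq_zero fun k hk => ?_
        rw [Finset.mem_filter] at hk
        simp [g', hk.2]
      rw [h1, zero_add]
      refine Finset.sum_congr rfl fun k hk => ?_
      rw [Finset.mem_filter] at hk
      simp [g', H', hk.2]

theorem eval_r2poly (x : E4) : MvPolynomial.eval (fun i => x i) r2poly = ‖x‖ ^ 2 := by
  rw [EuclideanSpace.real_norm_sq_eq]
  simp [r2poly, map_sum, map_pow]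

/-- T2′ from Fischer + LF + top-channel cone (verbatim from `sextic_channel` v5). -/
theorem finiteTypeRigidity_of (hF : FischerNormalForm) (hLF : LaplaceFourier) (hT : TopChannelCone) :
    FiniteTypeRigidity := by
  intro K hK N P g hrep
  obtain ⟨μ, hμ⟩ := hLF K hK
  classical
  choose M H d e hhom hharm hP using hF
  let ι := Σ j : Fin N, Fin (M (P j))
  let H' : ι → MvPolynomial (Fin 4) ℝ := fun km => H (P km.1) km.2
  let d' : ι → ℕ := fun km => d (P km.1) km.2
  let g' : ι → ℝ → ℝ := fun km s => g km.1 s * s ^ (e (P km.1) km.2)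
  have hL : ∀ km : ι, d' km ≤ Finset.univ.sup d' := fun km => Finset.le_sup (Finset.mem_univ km)
  refine radial_of_harmonicExpansion hT K hK μ hμ (Finset.univ.sup d') ι H' d' g' (fun km => hhom _ _)
    (fun km => hharm _ _) hL ?_
  intro x hx
  rw [hrep x hx]
  have hsig : ∑ km : ι, g' km (‖x‖ ^ 2) * MvPolynomial.eval (fun i => x i) (H' km)
      = ∑ j : Fin N, ∑ m : Fin (M (P j)), g' ⟨j, m⟩ (‖x‖ ^ 2) * MvPolynomial.eval (fun i => x i) (H' ⟨j, m⟩) :=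
    Fintype.sum_sigma (fun km : ι => g' km (‖x‖ ^ 2) * MvPolynomial.eval (fun i => x i) (H' km))
  rw [hsig]
  refine Finset.sum_congr rfl fun j _ => ?_
  have hPj := hP (P j)
  calc g j (‖x‖ ^ 2) * MvPolynomial.eval (fun i => x i) (P j)
      = g j (‖x‖ ^ 2) * MvPolynomial.eval (fun i => x i) (∑ m, r2poly ^ (e (P j) m) * H (P j) m) := by
        rw [← hPj]
    _ = ∑ m : Fin (M (P j)), g' ⟨j, m⟩ (‖x‖ ^ 2) * MvPolynomial.eval (fun i => x i) (H' ⟨j, m⟩) := by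
        rw [map_sum, Finset.mul_sum]
        refine Finset.sum_congr rfl fun m _ => ?_
        simp only [g', H', map_mul, map_pow, eval_r2poly]
        ring

/-- T1' and T2′ give C3 `GlobalShortRootRigidity`, spelled exactly as in the tree certificate (verbatim from `sextic_channel`). -/
theorem globalRigidity_of_channels (h1 : FiniteType) (h2 : FiniteTypeRigidity) :
    ∀ K : EuclideanSpace ℝ (Fin 4) → ℝ,
      ContinuousOn K {x | x ≠ 0} →
      (∃ C : ℝ, ∀ x, 1 ≤ ‖x‖ → |K x| ≤ C) →
      (∀ R : EuclideanSpace ℝ (Fin 4) ≃ₗᵢ[ℝ] EuclideanSpace ℝ (Fin 4), IsSignedPerm R → ∀ x, K (R x) = K x) →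
      (∀ (m : ℕ) (x : Fin m → EuclideanSpace ℝ (Fin 4)) (c : Fin m → ℝ), (∀ i, 0 < x i 0) →
          0 ≤ ∑ i, ∑ j, c i * c j * K (timeReflection 4 (x i) - x j)) →
      Tendsto (fun x : EuclideanSpace ℝ (Fin 4) => ‖x‖ ^ 8 * K x) (𝓝[≠] 0) (𝓝 0) →
      (∀ R : EuclideanSpace ℝ (Fin 4) ≃ₗᵢ[ℝ] EuclideanSpace ℝ (Fin 4),
          (∀ z : Fin 4 → ℤ, Even (∑ i, z i) → ∃ w : Fin 4 → ℤ, Even (∑ i, w i) ∧ R (siteToE z) = siteToE w) →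
          ∀ x, K (R x) = K x) →
      ∀ (R : EuclideanSpace ℝ (Fin 4) ≃ₗᵢ[ℝ] EuclideanSpace ℝ (Fin 4)) (x : EuclideanSpace ℝ (Fin 4)),
        K (R x) = K x := by
  intro K hK hbd hB hRP hbud hlat R x
  have hcls : InClass K := ⟨hK, hbd, hB, hRP, hbud, hlat⟩
  obtain ⟨N, P, g, hrep⟩ := h1 K hcls
  obtain ⟨g₀, hrad⟩ := h2 K hcls N P g hrep
  by_cases hx : x = 0
  · subst hx; simp
  · have hRx : R x ≠ 0 := by
      intro h0
      apply hx
      have hn : ‖R x‖ = 0 := by rw [h0, norm_zero]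
      rw [LinearIsometryEquiv.norm_map] at hn
      exact norm_eq_zero.mp hn
    rw [hrad (R x) hRx, hrad x hx, LinearIsometryEquiv.norm_map]

/-! ## SKELETON THEOREM: ⟨stmt-QuantumFields-23125⟩ `RationalToGeneral` BY NAME -/

/-- **SKELETON THEOREM (LINE g21-A)**: the served leaf ⟨23125⟩ `RationalToGeneral` from the registered stubs
`stub_forwardConeSupport`, `stub_shellSeparation`, `stub_shellFiniteType` (new), `stub_channelShellForm` (re-declared), the landed
obligations `stub_laplaceFourier`, `stub_fischerNormalForm`, `stub_nullConePointedness`, `stub_coneFatouEndgame` (tree, by name), the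
proved compositions above, and the tree certificate `rationalToGeneral_of_global`. -/
theorem RationalToGeneral_of_shells : RationalToGeneral :=
  rationalToGeneral_of_global
    (globalRigidity_of_channels
      (finiteType_of_shells stub_forwardConeSupport stub_shellSeparation stub_shellFiniteType)
      (finiteTypeRigidity_of stub_fischerNormalForm stub_laplaceFourier
        (topChannelCone_of nullConePointedness_holds stub_channelShellForm coneFatouEndgame_holds)))

end Summit.QuantumFields.YangMills.Cruxes.RationalToGeneral.ShellSeparation

end
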